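/-
Copyright (c) 2026 the pub-hodgecm-mathlib formalisation cell (harness21).  Prover seat hodgecm-mathlib-K2E4-p04 (g2),
Track B «K2-LIT» ∕ h413, unit «FinGermConstants» of the line `K2_E4_SingularTransferKappaSign`, socket #7R
`K2E4SingularTransferKappaSign.FinGermConstants.sig_K2E3GermConstantRegularHR` (ED. 3∕5): the CLOPEN STABLY SATURATED WINDOW near a point of `H_v`
(item (iv) of K2E4-p07's #7R residue plan, file F4 «NearCentral»).  2026-09-03.
-/
import Literature.NumberTheory.Rogawski1990.LocalTransferSaturationNonsplit              -- ★ (σ-SAT) `exists_isOpen_classMapH_saturation`, ★ `continuous_classMapH`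
import Literature.NumberTheory.Rogawski1990.FinExplicitTransferFactorStableInvariance   -- ★ `finCharpolyTwo_eq_of_isLocalStablyConjH`, ★ `finGammaTwo_eq_of_isLocalStablyConjH` (the class map is a stable class function)
import Literature.NumberTheory.Rogawski1990.LocalTransferGlueCM                         -- ★ `totallyDisconnectedSpace_localRing` (clopen basis of `∏_{w∣v} L_w`)
import Literature.NumberTheory.Rogawski1990.ExplicitFactorKappaAlmostEverywhereOne       -- ★ `smul_placesOver_eq_of_subsingleton` (one place above `v` ⇒ it is conjugation-fixed)
import Summits.HodgeConjecture.HodgeConjecture.Theorems.K2E3GermConstantRegularHRLocalReduction  -- ★ p854913 (K2E4-p07): `exists_transferPair_apply_ne_zero_of_local` (the consumer of the window)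
import HarnessLib

/-!
# K2_E4 road (h413 = stmt-HodgeConjecture-24833), unit «FinGermConstants», socket #7R `sig_K2E3GermConstantRegularHR` — the CLOPEN, STABLY SATURATED
# WINDOW: every neighbourhood of a point `z ∈ H_v` (non-split `v`) contains, ON THE `G`-REGULAR CLASSES, a clopen stably saturated neighbourhood of `z`

Cell `pub/hodgecm-mathlib` (D-0151), Track B (21-frontier RULING «PUSH BOTH» 2026-09-03), socket module
`Summits/HodgeConjecture/HodgeConjecture/Cruxes/H413/Lines/K2_E4_SingularTransferKappaSignSigsFinGermConstants.lean` (ED. 5 13692ab5a168510a), socket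
**`sig_K2E3GermConstantRegularHR`** (OWNER K2E3, host K2E4-plan, base K2E4-p07).  K2E4-p07's residue plan for the NON-SPLIT places (K2/STATUS.md 2026-09-03T21:47:00Z (iv),
22:07:26Z F4) asks for the «class-level central saturation»: the local-to-global reduction ★ `exists_transferPair_apply_ne_zero_of_local` (p854913 §3) wants (4.3.1)
on a CLOPEN, STABLY SATURATED `W ∋ z`, while the local pair of the plan (F3) delivers (4.3.1) on SOME stably saturated NEIGHBOURHOOD `V` of `z = ε_H`.  This file
closes that gap at every non-split `v`, for an ARBITRARY point `z ∈ H_v` (central or not).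

THE MATHEMATICS ([LanglandsShelstad1990Descent, §2.2 p. 11] «any regular `γ` close to `ε` is stably conjugate to a `γ′` close to `ε` because `G` is quasisplit»;
[Rogawski1990, §3.1 p. 19, §4.9 p. 54]).  Let `π : H_v → E_v³`, `π(g, u) = (det g, −tr g, u)` be the CLASS MAP (`E_v = ∏_{w∣v} L_w`).  It is continuous (★
`continuous_classMapH`) and constant on stable classes (★ `finCharpolyTwo_eq_of_isLocalStablyConjH`, ★ `finGammaTwo_eq_of_isLocalStablyConjH`), so every
`π⁻¹(C)` with `C` clopen is a clopen, stably saturated subset of `H_v` (`E_v³` is locally compact, Hausdorff and totally disconnected: ★ `totallyDisconnectedSpace_localRing`,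
Mathlib `loc_compact_Haus_tot_disc_of_zero_dim`).  By SATURATION (★ (σ-SAT) `exists_isOpen_classMapH_saturation`, non-split `v`: explicit Borel sections of the
quasi-split rank-one unitary group) there is an open `O ∋ π(z)` such that every `G`-regular `γ_H` with `π(γ_H) ∈ O` is stably conjugate to a point of `V`; choosing
`C ∋ π(z)` clopen inside `O` gives the window `W := π⁻¹(C)`: clopen, stably saturated, `z ∈ W`, and every `G`-regular `γ_H ∈ W` is stably conjugate INTO `V` — hence
lies in `V` when `V` is stably saturated.  Consequently (4.3.1) on the `G`-regular points of a stably saturated neighbourhood `V ∋ z` already feeds p854913 §3.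

* §1 **`exists_isClopen_saturated_window_of_nhds`** — the window `W` for an arbitrary `V ∈ 𝓝 z` (conclusion: `G`-regular points of `W` are stably conjugate into `V`).
* §2 **`exists_isClopen_saturated_window_subset_of_saturated`** — for stably saturated `V`: the `G`-regular points of `W` lie in `V`.
* §3 **`exists_transferPair_apply_ne_zero_of_saturated_nhds`** — p854913 §3 with its clopen window replaced by ANY stably saturated neighbourhood `V ∋ z` carrying
  (4.3.1) at its `G`-regular points: `∃ (f^H, f)` smooth, `IsLocalDeltaTransfer … f^H f`, `f^H(z) ≠ 0` — the conclusion of #7R at a non-split `v`, token for token.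
* §4 **`exists_transferPair_apply_ne_zero_of_saturated_nhds_of_subsingleton`** — §3 under the sockets' spelling `Subsingleton (UnitaryGroup.PlacesOver L v)` of «non-split».
* §5 **`exists_transferPair_apply_ne_zero_of_nhds`** — NO saturation hypothesis on `V` when `Δ_v(·, γ)` is a stable class function (`hTst`): (4.3.1) propagates from `V` to
  the window along stable classes (★ `stableOrbitalIntegralRel_congr`, ★ `isGRegular_of_isStablyConjH`).
* §6 **`exists_transferPair_apply_ne_zero_of_nhds_finExplicitCollection`** — §5 for the explicit factor `(finExplicitCollection L H′ μ hl hr) v` (★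
  `finExplicitCollection_Δ_eq_of_isLocalStablyConjH`) under `Subsingleton (PlacesOver L v)`: the DOCKING FORM — input = the output shape of ★ p855223
  `K2E3GermConstantRegularHRLocalPair.exists_nhds_stableOrbitalIntegralRel_smul_eq_of_dockSide` + a value at `z` + ★ `IsLocalDeltaTransferExists`; output = #7R at `v`.

HONEST LABEL: HC_CM is proved only modulo the 7 printed citations (2 remaining named inputs: hLiu418 = stmt-HodgeConjecture-24832, h413 =
stmt-HodgeConjecture-24833) until rung 0 closes; this file is a `--supports stmt-HodgeConjecture-24833` helper (pure topology of `H_v`) and retires nothing by itself.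

## References
* [LanglandsShelstad1990Descent] R. P. Langlands, D. Shelstad, *Descent for transfer factors*, The Grothendieck Festschrift II, Progr. Math. 87 (1990), §2.2 Lemma 2.2.A p. 11.
* [Rogawski1990] J. D. Rogawski, *Automorphic Representations of Unitary Groups in Three Variables*, Ann. of Math. Stud. 123 (1990), §3.1 p. 19, §4.3 (4.3.1) p. 43, §4.9 pp. 54–55,
  Prop. 8.1.3 p. 116.
-/

set_option autoImplicit false
set_option linter.dupNamespace false

noncomputable section

open MeasureTheory NumberField IsDedekindDomain Filter Topology
open Literature.NumberTheory.Rogawski1990 Literature.NumberTheory.Automorphic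
open scoped Matrix MatrixGroups

namespace Summit.HodgeConjecture.HodgeConjecture.Cruxes.H413.K2E3GermConstantRegularHRNearCentral

variable (L : Type) [Field L] [NumberField L] [IsCMField L]
  (v : HeightOneSpectrum (𝓞 ↥(maximalRealSubfield L)))

/-! ## §1  The clopen, stably saturated window inside (the stable saturation of) any neighbourhood -/

/-- **THE WINDOW.**  At a NON-SPLIT place `v` (`w ∣ v` fixed by complex conjugation), for every `z ∈ H_v = U(Φ₂)_v × U(Φ₁)_v` and every neighbourhood `V ∋ z`
there is a CLOPEN, STABLY SATURATED `W ∋ z` all of whose `G`-regular points are stably conjugate to points of `V`: `W = π⁻¹(C)` for a clopen `C ∋ π(z)` inside the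
open set of ★ (σ-SAT) `exists_isOpen_classMapH_saturation`, `π = (det g, −tr g, u)` the continuous (★ `continuous_classMapH`) stable-class-function class map.
[cite: LanglandsShelstad1990Descent, §2.2 Lemma 2.2.A p. 11] [cite: Rogawski1990, §3.1 p. 19; §4.9 p. 54] -/
theorem exists_isClopen_saturated_window_of_nhds (w : UnitaryGroup.PlacesOver L v) (hw : IsCMField.complexConj L • w.1 = w.1)
    (z : (UnitaryGroup.cmDatum L 2 (Matrix.of fun i j : Fin 2 => if i.val + j.val + 1 = 2 then (1 : L) else 0)).Local v ×
      (UnitaryGroup.cmDatum L 1 (Matrix.of fun i j : Fin 1 => if i.val + j.val + 1 = 1 then (1 : L) else 0)).Local v)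
    {V : Set ((UnitaryGroup.cmDatum L 2 (Matrix.of fun i j : Fin 2 => if i.val + j.val + 1 = 2 then (1 : L) else 0)).Local v ×
      (UnitaryGroup.cmDatum L 1 (Matrix.of fun i j : Fin 1 => if i.val + j.val + 1 = 1 then (1 : L) else 0)).Local v)} (hV : V ∈ 𝓝 z) :
    ∃ W : Set ((UnitaryGroup.cmDatum L 2 (Matrix.of fun i j : Fin 2 => if i.val + j.val + 1 = 2 then (1 : L) else 0)).Local v ×
        (UnitaryGroup.cmDatum L 1 (Matrix.of fun i j : Fin 1 => if i.val + j.val + 1 = 1 then (1 : L) else 0)).Local v),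
      IsClopen W ∧ z ∈ W ∧
      (∀ a b : (UnitaryGroup.cmDatum L 2 (Matrix.of fun i j : Fin 2 => if i.val + j.val + 1 = 2 then (1 : L) else 0)).Local v ×
          (UnitaryGroup.cmDatum L 1 (Matrix.of fun i j : Fin 1 => if i.val + j.val + 1 = 1 then (1 : L) else 0)).Local v, IsLocalStablyConjH L v a b → a ∈ W → b ∈ W) ∧
      ∀ γ ∈ W, IsLocalGRegular L v γ → ∃ γ' ∈ V, IsLocalStablyConjH L v γ γ' := by
  haveI := totallyDisconnectedSpace_localRing L v
  -- the class map
  let π : (UnitaryGroup.cmDatum L 2 (Matrix.of fun i j : Fin 2 => if i.val + j.val + 1 = 2 then (1 : L) else 0)).Local v ×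
        (UnitaryGroup.cmDatum L 1 (Matrix.of fun i j : Fin 1 => if i.val + j.val + 1 = 1 then (1 : L) else 0)).Local v →
      UnitaryGroup.LocalRing L v × UnitaryGroup.LocalRing L v × UnitaryGroup.LocalRing L v :=
    fun a => ((finCharpolyTwo L v a).coeff 0, (finCharpolyTwo L v a).coeff 1, finGammaTwo L v a)
  have hπc : Continuous π := continuous_classMapH L v
  -- saturation: an open `O ∋ π z` whose `G`-regular fibre points are stably conjugate into `V`
  obtain ⟨O, hOo, hzO, hO⟩ := exists_isOpen_classMapH_saturation L v w hw z hV
  -- a clopen `C` with `π z ∈ C ⊆ O`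
  obtain ⟨C, hC, hzC, hCO⟩ := (loc_compact_Haus_tot_disc_of_zero_dim
    (H := UnitaryGroup.LocalRing L v × UnitaryGroup.LocalRing L v × UnitaryGroup.LocalRing L v)).mem_nhds_iff.1 (hOo.mem_nhds hzO)
  refine ⟨π ⁻¹' C, hC.preimage hπc, hzC, fun a b hab ha => ?_, fun γ hγ hreg => hO γ hreg (hCO hγ)⟩
  -- the class map is a stable class function
  have hπeq : π b = π a := by
    show ((finCharpolyTwo L v b).coeff 0, (finCharpolyTwo L v b).coeff 1, finGammaTwo L v b) =
      ((finCharpolyTwo L v a).coeff 0, (finCharpolyTwo L v a).coeff 1, finGammaTwo L v a)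
    rw [finCharpolyTwo_eq_of_isLocalStablyConjH L v hab, finGammaTwo_eq_of_isLocalStablyConjH L v hab]
  show π b ∈ C
  rw [hπeq]
  exact ha

/-! ## §2  Stably saturated neighbourhoods contain the window's `G`-regular points -/

/-- **THE WINDOW INSIDE A STABLY SATURATED NEIGHBOURHOOD.**  If `V ∋ z` is a stably saturated neighbourhood (non-split `v`), the window `W ∋ z` of §1 is clopen, stably
saturated, and its `G`-REGULAR points lie in `V` (a `G`-regular `γ_H ∈ W` is stably conjugate to some `γ_H′ ∈ V`, and `V` is closed under stable conjugacy).
This is item (iv) «clopen-ness of a stably saturated window ⊆ V» of the #7R residue plan (K2E4-p07, K2/STATUS.md 2026-09-03T21:47:00Z).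
[cite: LanglandsShelstad1990Descent, §2.2 Lemma 2.2.A p. 11] [cite: Rogawski1990, §3.1 p. 19; Prop. 8.1.3 proof p. 116] -/
theorem exists_isClopen_saturated_window_subset_of_saturated (w : UnitaryGroup.PlacesOver L v) (hw : IsCMField.complexConj L • w.1 = w.1)
    (z : (UnitaryGroup.cmDatum L 2 (Matrix.of fun i j : Fin 2 => if i.val + j.val + 1 = 2 then (1 : L) else 0)).Local v ×
      (UnitaryGroup.cmDatum L 1 (Matrix.of fun i j : Fin 1 => if i.val + j.val + 1 = 1 then (1 : L) else 0)).Local v)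
    {V : Set ((UnitaryGroup.cmDatum L 2 (Matrix.of fun i j : Fin 2 => if i.val + j.val + 1 = 2 then (1 : L) else 0)).Local v ×
      (UnitaryGroup.cmDatum L 1 (Matrix.of fun i j : Fin 1 => if i.val + j.val + 1 = 1 then (1 : L) else 0)).Local v)} (hV : V ∈ 𝓝 z)
    (hVsat : ∀ a b : (UnitaryGroup.cmDatum L 2 (Matrix.of fun i j : Fin 2 => if i.val + j.val + 1 = 2 then (1 : L) else 0)).Local v ×
        (UnitaryGroup.cmDatum L 1 (Matrix.of fun i j : Fin 1 => if i.val + j.val + 1 = 1 then (1 : L) else 0)).Local v, IsLocalStablyConjH L v a b → a ∈ V → b ∈ V) :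
    ∃ W : Set ((UnitaryGroup.cmDatum L 2 (Matrix.of fun i j : Fin 2 => if i.val + j.val + 1 = 2 then (1 : L) else 0)).Local v ×
        (UnitaryGroup.cmDatum L 1 (Matrix.of fun i j : Fin 1 => if i.val + j.val + 1 = 1 then (1 : L) else 0)).Local v),
      IsClopen W ∧ z ∈ W ∧
      (∀ a b : (UnitaryGroup.cmDatum L 2 (Matrix.of fun i j : Fin 2 => if i.val + j.val + 1 = 2 then (1 : L) else 0)).Local v ×
          (UnitaryGroup.cmDatum L 1 (Matrix.of fun i j : Fin 1 => if i.val + j.val + 1 = 1 then (1 : L) else 0)).Local v, IsLocalStablyConjH L v a b → a ∈ W → b ∈ W) ∧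
      ∀ γ ∈ W, IsLocalGRegular L v γ → γ ∈ V := by
  obtain ⟨W, hWcl, hzW, hWsat, hWV⟩ := exists_isClopen_saturated_window_of_nhds L v w hw z hV
  refine ⟨W, hWcl, hzW, hWsat, fun γ hγ hreg => ?_⟩
  obtain ⟨γ', hγ'V, hst⟩ := hWV γ hγ hreg
  exact hVsat γ' γ hst.symm hγ'V

/-! ## §3  #7R at a non-split place from (4.3.1) on a stably saturated NEIGHBOURHOOD with a value at `z` -/

section Patch

variable {L v} {H' : Matrix (Fin 3) (Fin 3) L}
variable [∀ a : ((UnitaryGroup.cmDatum L 2 (Matrix.of fun i j : Fin 2 => if i.val + j.val + 1 = 2 then (1 : L) else 0)).Local v × (UnitaryGroup.cmDatum L 1 (Matrix.of fun i j : Fin 1 => if i.val + j.val + 1 = 1 then (1 : L) else 0)).Local v), MeasurableSpace (((UnitaryGroup.cmDatum L 2 (Matrix.of fun i j : Fin 2 => if i.val + j.val + 1 = 2 then (1 : L) else 0)).Local v × (UnitaryGroup.cmDatum L 1 (Matrix.of fun i j : Fin 1 => if i.val + j.val + 1 = 1 then (1 : L) else 0)).Local v) ⧸ Subgroup.centralizer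 ({a} : Set ((UnitaryGroup.cmDatum L 2 (Matrix.of fun i j : Fin 2 => if i.val + j.val + 1 = 2 then (1 : L) else 0)).Local v × (UnitaryGroup.cmDatum L 1 (Matrix.of fun i j : Fin 1 => if i.val + j.val + 1 = 1 then (1 : L) else 0)).Local v)))]
  [∀ γ : ((UnitaryGroup.cmDatum L 3 H').Local v), MeasurableSpace (((UnitaryGroup.cmDatum L 3 H').Local v) ⧸ Subgroup.centralizer ({γ} : Set ((UnitaryGroup.cmDatum L 3 H').Local v)))]

/-- **#7R AT A NON-SPLIT PLACE, FROM A LOCAL PAIR ON A STABLY SATURATED NEIGHBOURHOOD.**  Let `(Δ_v, m_H, m_G)` admit a smooth transfer of every smooth `φ`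
(★ `IsLocalDeltaTransferExists`), let `V ∋ z` be a stably saturated NEIGHBOURHOOD of `z`, and let `(φ^H, φ)` be a smooth pair satisfying (4.3.1) at the `G`-regular
points of `V` with `φ^H(z) ≠ 0`.  Then some smooth `Δ_v`-transfer pair `(f^H, f)` has `f^H(z) ≠ 0`: shrink `V` to the clopen stably saturated window of §2 and apply
★ `exists_transferPair_apply_ne_zero_of_local` (p854913 §3: patch `1_W·φ^H + 1_{Wᶜ}·g`).  Any ★ `LocalTransferFactor`, any measure families.
[cite: Rogawski1990, §4.3 (4.3.1) p. 43; Prop. 8.1.3 proof p. 116; §8.2 Prop. 8.2.1 (a) p. 118] [cite: LanglandsShelstad1990Descent, §2.2 Lemma 2.2.A p. 11] -/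
theorem exists_transferPair_apply_ne_zero_of_saturated_nhds (w : UnitaryGroup.PlacesOver L v) (hw : IsCMField.complexConj L • w.1 = w.1)
    {T : LocalTransferFactor L H' v}
    {mH : OrbitalMeasureFamily ((UnitaryGroup.cmDatum L 2 (Matrix.of fun i j : Fin 2 => if i.val + j.val + 1 = 2 then (1 : L) else 0)).Local v × (UnitaryGroup.cmDatum L 1 (Matrix.of fun i j : Fin 1 => if i.val + j.val + 1 = 1 then (1 : L) else 0)).Local v)} {mG : OrbitalMeasureFamily ((UnitaryGroup.cmDatum L 3 H').Local v)}
    (hex : IsLocalDeltaTransferExists L H' v T mH mG IsLocSmooth IsLocSmooth)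
    {z : ((UnitaryGroup.cmDatum L 2 (Matrix.of fun i j : Fin 2 => if i.val + j.val + 1 = 2 then (1 : L) else 0)).Local v × (UnitaryGroup.cmDatum L 1 (Matrix.of fun i j : Fin 1 => if i.val + j.val + 1 = 1 then (1 : L) else 0)).Local v)}
    {V : Set ((UnitaryGroup.cmDatum L 2 (Matrix.of fun i j : Fin 2 => if i.val + j.val + 1 = 2 then (1 : L) else 0)).Local v × (UnitaryGroup.cmDatum L 1 (Matrix.of fun i j : Fin 1 => if i.val + j.val + 1 = 1 then (1 : L) else 0)).Local v)} (hV : V ∈ 𝓝 z)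
    (hVsat : ∀ a b : ((UnitaryGroup.cmDatum L 2 (Matrix.of fun i j : Fin 2 => if i.val + j.val + 1 = 2 then (1 : L) else 0)).Local v × (UnitaryGroup.cmDatum L 1 (Matrix.of fun i j : Fin 1 => if i.val + j.val + 1 = 1 then (1 : L) else 0)).Local v), IsLocalStablyConjH L v a b → a ∈ V → b ∈ V)
    {φH : ((UnitaryGroup.cmDatum L 2 (Matrix.of fun i j : Fin 2 => if i.val + j.val + 1 = 2 then (1 : L) else 0)).Local v × (UnitaryGroup.cmDatum L 1 (Matrix.of fun i j : Fin 1 => if i.val + j.val + 1 = 1 then (1 : L) else 0)).Local v) → ℂ} {φ : ((UnitaryGroup.cmDatum L 3 H').Local v) → ℂ} (hφH : IsLocSmooth φH) (hφs : IsLocSmooth φ)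
    (hloc : ∀ γH : ((UnitaryGroup.cmDatum L 2 (Matrix.of fun i j : Fin 2 => if i.val + j.val + 1 = 2 then (1 : L) else 0)).Local v × (UnitaryGroup.cmDatum L 1 (Matrix.of fun i j : Fin 1 => if i.val + j.val + 1 = 1 then (1 : L) else 0)).Local v), γH ∈ V → IsLocalGRegular L v γH →
      stableOrbitalIntegralRel (IsLocalStablyConjH L v) mH φH γH = ∑ᶠ c : ConjClasses ((UnitaryGroup.cmDatum L 3 H').Local v), T.Δ γH (Quotient.out c) * classOrbitalIntegral mG φ c)
    (hval : φH z ≠ 0) :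
    ∃ (fH : ((UnitaryGroup.cmDatum L 2 (Matrix.of fun i j : Fin 2 => if i.val + j.val + 1 = 2 then (1 : L) else 0)).Local v × (UnitaryGroup.cmDatum L 1 (Matrix.of fun i j : Fin 1 => if i.val + j.val + 1 = 1 then (1 : L) else 0)).Local v) → ℂ) (f : ((UnitaryGroup.cmDatum L 3 H').Local v) → ℂ),
      IsLocSmooth f ∧ IsLocSmooth fH ∧ IsLocalDeltaTransfer L H' v T mH mG fH f ∧ fH z ≠ 0 := by
  obtain ⟨W, hWcl, hzW, hWsat, hWV⟩ := exists_isClopen_saturated_window_subset_of_saturated L v w hw z hV hVsat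
  exact K2E3GermConstantRegularHRLocalReduction.exists_transferPair_apply_ne_zero_of_local hex hWcl hWsat hzW hφH hφs
    (fun γH hγ hreg => hloc γH (hWV γH hγ hreg) hreg) hval

/-! ## §4  The same under the sockets' non-split hypothesis `Subsingleton (PlacesOver L v)` -/

/-- **#7R AT A NON-SPLIT PLACE, socket form.**  §3 with the non-split hypothesis spelled as in the `FinGermConstants` sockets, `Subsingleton (UnitaryGroup.PlacesOver L v)`
(one place of `L` above `v`; then that place is fixed by complex conjugation, ★ `smul_placesOver_eq_of_subsingleton`): a smooth pair with (4.3.1) on the `G`-regular points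
of a stably saturated neighbourhood `V ∋ z` and a value at `z`, plus ★ `IsLocalDeltaTransferExists`, give a smooth `Δ_v`-transfer pair charging `z`.
[cite: Rogawski1990, §4.3 (4.3.1) p. 43; Prop. 8.1.3 proof p. 116; §8.2 Prop. 8.2.1 (a) p. 118] [cite: LanglandsShelstad1990Descent, §2.2 Lemma 2.2.A p. 11] -/
theorem exists_transferPair_apply_ne_zero_of_saturated_nhds_of_subsingleton (hv : Subsingleton (UnitaryGroup.PlacesOver L v))
    {T : LocalTransferFactor L H' v}
    {mH : OrbitalMeasureFamily ((UnitaryGroup.cmDatum L 2 (Matrix.of fun i j : Fin 2 => if i.val + j.val + 1 = 2 then (1 : L) else 0)).Local v × (UnitaryGroup.cmDatum L 1 (Matrix.of fun i j : Fin 1 => if i.val + j.val + 1 = 1 then (1 : L) else 0)).Local v)} {mG : OrbitalMeasureFamily ((UnitaryGroup.cmDatum L 3 H').Local v)}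
    (hex : IsLocalDeltaTransferExists L H' v T mH mG IsLocSmooth IsLocSmooth)
    {z : ((UnitaryGroup.cmDatum L 2 (Matrix.of fun i j : Fin 2 => if i.val + j.val + 1 = 2 then (1 : L) else 0)).Local v × (UnitaryGroup.cmDatum L 1 (Matrix.of fun i j : Fin 1 => if i.val + j.val + 1 = 1 then (1 : L) else 0)).Local v)}
    {V : Set ((UnitaryGroup.cmDatum L 2 (Matrix.of fun i j : Fin 2 => if i.val + j.val + 1 = 2 then (1 : L) else 0)).Local v × (UnitaryGroup.cmDatum L 1 (Matrix.of fun i j : Fin 1 => if i.val + j.val + 1 = 1 then (1 : L) else 0)).Local v)} (hV : V ∈ 𝓝 z)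
    (hVsat : ∀ a b : ((UnitaryGroup.cmDatum L 2 (Matrix.of fun i j : Fin 2 => if i.val + j.val + 1 = 2 then (1 : L) else 0)).Local v × (UnitaryGroup.cmDatum L 1 (Matrix.of fun i j : Fin 1 => if i.val + j.val + 1 = 1 then (1 : L) else 0)).Local v), IsLocalStablyConjH L v a b → a ∈ V → b ∈ V)
    {φH : ((UnitaryGroup.cmDatum L 2 (Matrix.of fun i j : Fin 2 => if i.val + j.val + 1 = 2 then (1 : L) else 0)).Local v × (UnitaryGroup.cmDatum L 1 (Matrix.of fun i j : Fin 1 => if i.val + j.val + 1 = 1 then (1 : L) else 0)).Local v) → ℂ} {φ : ((UnitaryGroup.cmDatum L 3 H').Local v) → ℂ} (hφH : IsLocSmooth φH) (hφs : IsLocSmooth φ)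
    (hloc : ∀ γH : ((UnitaryGroup.cmDatum L 2 (Matrix.of fun i j : Fin 2 => if i.val + j.val + 1 = 2 then (1 : L) else 0)).Local v × (UnitaryGroup.cmDatum L 1 (Matrix.of fun i j : Fin 1 => if i.val + j.val + 1 = 1 then (1 : L) else 0)).Local v), γH ∈ V → IsLocalGRegular L v γH →
      stableOrbitalIntegralRel (IsLocalStablyConjH L v) mH φH γH = ∑ᶠ c : ConjClasses ((UnitaryGroup.cmDatum L 3 H').Local v), T.Δ γH (Quotient.out c) * classOrbitalIntegral mG φ c)
    (hval : φH z ≠ 0) :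
    ∃ (fH : ((UnitaryGroup.cmDatum L 2 (Matrix.of fun i j : Fin 2 => if i.val + j.val + 1 = 2 then (1 : L) else 0)).Local v × (UnitaryGroup.cmDatum L 1 (Matrix.of fun i j : Fin 1 => if i.val + j.val + 1 = 1 then (1 : L) else 0)).Local v) → ℂ) (f : ((UnitaryGroup.cmDatum L 3 H').Local v) → ℂ),
      IsLocSmooth f ∧ IsLocSmooth fH ∧ IsLocalDeltaTransfer L H' v T mH mG fH f ∧ fH z ≠ 0 := by
  obtain ⟨w⟩ : Nonempty (UnitaryGroup.PlacesOver L v) := inferInstance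
  exact exists_transferPair_apply_ne_zero_of_saturated_nhds w (smul_placesOver_eq_of_subsingleton L v (IsCMField.complexConj L) hv w)
    hex hV hVsat hφH hφs hloc hval

/-! ## §5  No saturation hypothesis on `V` when `Δ_v(·, γ)` is a stable class function: (4.3.1) propagates along stable classes -/

/-- **#7R AT A NON-SPLIT PLACE, FROM (4.3.1) ON A BARE NEIGHBOURHOOD.**  If `Δ_v(γ_H, γ)` depends only on the stable class of `γ_H` (`hTst`; print: «`Δ_{G∕H}(γ_H, γ)` depends
only on the stable conjugacy class of `γ_H`»), then (4.3.1) for a pair `(φ^H, φ)` at the `G`-regular points of ANY neighbourhood `V ∋ z` (not assumed saturated) propagates to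
the clopen stably saturated window `W ∋ z` of §1: a `G`-regular `γ_H ∈ W` is stably conjugate to a `G`-regular `γ_H′ ∈ V` (★ `isGRegular_of_isStablyConjH`), both sides of
(4.3.1) agree at `γ_H` and `γ_H′` (★ `stableOrbitalIntegralRel_congr`; `hTst`) — the saturation step ★ `forall_stableOrbitalIntegralRel_eq_of_saturation` in this frame.
With `φ^H(z) ≠ 0` and ★ `IsLocalDeltaTransferExists`, ★ p854913 §3 then yields a smooth `Δ_v`-transfer pair charging `z`.
[cite: Rogawski1990, §4.3 (4.3.1) p. 43; Prop. 8.1.3 proof p. 116] [cite: LanglandsShelstad1990Descent, §2.2 Lemma 2.2.A p. 11] -/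
theorem exists_transferPair_apply_ne_zero_of_nhds (w : UnitaryGroup.PlacesOver L v) (hw : IsCMField.complexConj L • w.1 = w.1)
    {T : LocalTransferFactor L H' v}
    {mH : OrbitalMeasureFamily ((UnitaryGroup.cmDatum L 2 (Matrix.of fun i j : Fin 2 => if i.val + j.val + 1 = 2 then (1 : L) else 0)).Local v × (UnitaryGroup.cmDatum L 1 (Matrix.of fun i j : Fin 1 => if i.val + j.val + 1 = 1 then (1 : L) else 0)).Local v)} {mG : OrbitalMeasureFamily ((UnitaryGroup.cmDatum L 3 H').Local v)}
    (hex : IsLocalDeltaTransferExists L H' v T mH mG IsLocSmooth IsLocSmooth)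
    (hTst : ∀ (a a' : ((UnitaryGroup.cmDatum L 2 (Matrix.of fun i j : Fin 2 => if i.val + j.val + 1 = 2 then (1 : L) else 0)).Local v × (UnitaryGroup.cmDatum L 1 (Matrix.of fun i j : Fin 1 => if i.val + j.val + 1 = 1 then (1 : L) else 0)).Local v))
      (b : (UnitaryGroup.cmDatum L 3 H').Local v), IsLocalStablyConjH L v a a' → T.Δ a' b = T.Δ a b)
    {z : ((UnitaryGroup.cmDatum L 2 (Matrix.of fun i j : Fin 2 => if i.val + j.val + 1 = 2 then (1 : L) else 0)).Local v × (UnitaryGroup.cmDatum L 1 (Matrix.of fun i j : Fin 1 => if i.val + j.val + 1 = 1 then (1 : L) else 0)).Local v)}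
    {V : Set ((UnitaryGroup.cmDatum L 2 (Matrix.of fun i j : Fin 2 => if i.val + j.val + 1 = 2 then (1 : L) else 0)).Local v × (UnitaryGroup.cmDatum L 1 (Matrix.of fun i j : Fin 1 => if i.val + j.val + 1 = 1 then (1 : L) else 0)).Local v)} (hV : V ∈ 𝓝 z)
    {φH : ((UnitaryGroup.cmDatum L 2 (Matrix.of fun i j : Fin 2 => if i.val + j.val + 1 = 2 then (1 : L) else 0)).Local v × (UnitaryGroup.cmDatum L 1 (Matrix.of fun i j : Fin 1 => if i.val + j.val + 1 = 1 then (1 : L) else 0)).Local v) → ℂ} {φ : ((UnitaryGroup.cmDatum L 3 H').Local v) → ℂ} (hφH : IsLocSmooth φH) (hφs : IsLocSmooth φ)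
    (hloc : ∀ γH : ((UnitaryGroup.cmDatum L 2 (Matrix.of fun i j : Fin 2 => if i.val + j.val + 1 = 2 then (1 : L) else 0)).Local v × (UnitaryGroup.cmDatum L 1 (Matrix.of fun i j : Fin 1 => if i.val + j.val + 1 = 1 then (1 : L) else 0)).Local v), γH ∈ V → IsLocalGRegular L v γH →
      stableOrbitalIntegralRel (IsLocalStablyConjH L v) mH φH γH = ∑ᶠ c : ConjClasses ((UnitaryGroup.cmDatum L 3 H').Local v), T.Δ γH (Quotient.out c) * classOrbitalIntegral mG φ c)
    (hval : φH z ≠ 0) :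
    ∃ (fH : ((UnitaryGroup.cmDatum L 2 (Matrix.of fun i j : Fin 2 => if i.val + j.val + 1 = 2 then (1 : L) else 0)).Local v × (UnitaryGroup.cmDatum L 1 (Matrix.of fun i j : Fin 1 => if i.val + j.val + 1 = 1 then (1 : L) else 0)).Local v) → ℂ) (f : ((UnitaryGroup.cmDatum L 3 H').Local v) → ℂ),
      IsLocSmooth f ∧ IsLocSmooth fH ∧ IsLocalDeltaTransfer L H' v T mH mG fH f ∧ fH z ≠ 0 := by
  obtain ⟨W, hWcl, hzW, hWsat, hWV⟩ := exists_isClopen_saturated_window_of_nhds L v w hw z hV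
  refine K2E3GermConstantRegularHRLocalReduction.exists_transferPair_apply_ne_zero_of_local hex hWcl hWsat hzW hφH hφs
    (fun γH hγ hreg => ?_) hval
  -- propagate (4.3.1) from a stably conjugate `G`-regular point of `V`
  obtain ⟨γ', hγ'V, hst⟩ := hWV γH hγ hreg
  have hreg' : IsLocalGRegular L v γ' := isGRegular_of_isStablyConjH _ _ _ _ hst hreg
  rw [stableOrbitalIntegralRel_congr (st := IsLocalStablyConjH L v) (γ := γH) (δ := γ')
      (fun e => ⟨fun h => hst.symm.trans h, fun h => hst.trans h⟩) mH φH, hloc γ' hγ'V hreg']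
  exact finsum_congr fun c => by rw [hTst γH γ' (Quotient.out c) hst]

/-! ## §6  The explicit factor `Δ‴_v`: docking form for the pinned socket #7R -/

/-- **#7R AT A NON-SPLIT PLACE FOR THE EXPLICIT FACTOR, socket form.**  For Rogawski's explicit factor `Δ_v = (finExplicitCollection L H′ μ hl hr) v` — whose value is a
stable class function of `γ_H` (★ `finExplicitCollection_Δ_eq_of_isLocalStablyConjH`) — at a place with one place of `L` above it (`Subsingleton (PlacesOver L v)`, ★
`smul_placesOver_eq_of_subsingleton`): a smooth pair `(φ^H, φ)` with (4.3.1) at the `G`-regular points of SOME neighbourhood `V ∋ z` and `φ^H(z) ≠ 0`, together with ★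
`IsLocalDeltaTransferExists`, gives a smooth `Δ_v`-transfer pair `(f^H, f)` with `f^H(z) ≠ 0` — the conclusion of `sig_K2E3GermConstantRegularHR` at `v`, token for token.
This is the shape ★ `K2E3GermConstantRegularHRLocalPair.exists_nhds_stableOrbitalIntegralRel_smul_eq_of_dockSide` (p855223) produces.
[cite: Rogawski1990, §4.3 (4.3.1) p. 43; §4.9 p. 55; Prop. 8.1.3 proof p. 116; §8.2 Prop. 8.2.1 (a) p. 118] [cite: LanglandsShelstad1990Descent, §2.2 Lemma 2.2.A p. 11] -/
theorem exists_transferPair_apply_ne_zero_of_nhds_finExplicitCollection (hv : Subsingleton (UnitaryGroup.PlacesOver L v))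
    (μ : Literature.NumberTheory.GaloisRepresentations.HeckeCharacter L)
    (hl : ∀ (v : HeightOneSpectrum (𝓞 ↥(maximalRealSubfield L))) (a : ((UnitaryGroup.cmDatum L 2 (Matrix.of fun i j : Fin 2 => if i.val + j.val + 1 = 2 then (1 : L) else 0)).Local v ×
      (UnitaryGroup.cmDatum L 1 (Matrix.of fun i j : Fin 1 => if i.val + j.val + 1 = 1 then (1 : L) else 0)).Local v)) (b : (UnitaryGroup.cmDatum L 3 H').Local v) (x : ((UnitaryGroup.cmDatum L 2 (Matrix.of fun i j : Fin 2 => if i.val + j.val + 1 = 2 then (1 : L) else 0)).Local v ×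
      (UnitaryGroup.cmDatum L 1 (Matrix.of fun i j : Fin 1 => if i.val + j.val + 1 = 1 then (1 : L) else 0)).Local v)),
      finExplicitDelta L v H' (x * a * x⁻¹) μ b = finExplicitDelta L v H' a μ b)
    (hr : ∀ (v : HeightOneSpectrum (𝓞 ↥(maximalRealSubfield L))) (a : ((UnitaryGroup.cmDatum L 2 (Matrix.of fun i j : Fin 2 => if i.val + j.val + 1 = 2 then (1 : L) else 0)).Local v ×
      (UnitaryGroup.cmDatum L 1 (Matrix.of fun i j : Fin 1 => if i.val + j.val + 1 = 1 then (1 : L) else 0)).Local v)) (b y : (UnitaryGroup.cmDatum L 3 H').Local v),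
      finExplicitDelta L v H' a μ (y * b * y⁻¹) = finExplicitDelta L v H' a μ b)
    {mH : OrbitalMeasureFamily ((UnitaryGroup.cmDatum L 2 (Matrix.of fun i j : Fin 2 => if i.val + j.val + 1 = 2 then (1 : L) else 0)).Local v × (UnitaryGroup.cmDatum L 1 (Matrix.of fun i j : Fin 1 => if i.val + j.val + 1 = 1 then (1 : L) else 0)).Local v)} {mG : OrbitalMeasureFamily ((UnitaryGroup.cmDatum L 3 H').Local v)}
    (hex : IsLocalDeltaTransferExists L H' v (finExplicitCollection L H' μ hl hr v) mH mG IsLocSmooth IsLocSmooth)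
    {z : ((UnitaryGroup.cmDatum L 2 (Matrix.of fun i j : Fin 2 => if i.val + j.val + 1 = 2 then (1 : L) else 0)).Local v × (UnitaryGroup.cmDatum L 1 (Matrix.of fun i j : Fin 1 => if i.val + j.val + 1 = 1 then (1 : L) else 0)).Local v)}
    {V : Set ((UnitaryGroup.cmDatum L 2 (Matrix.of fun i j : Fin 2 => if i.val + j.val + 1 = 2 then (1 : L) else 0)).Local v × (UnitaryGroup.cmDatum L 1 (Matrix.of fun i j : Fin 1 => if i.val + j.val + 1 = 1 then (1 : L) else 0)).Local v)} (hV : V ∈ 𝓝 z)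
    {φH : ((UnitaryGroup.cmDatum L 2 (Matrix.of fun i j : Fin 2 => if i.val + j.val + 1 = 2 then (1 : L) else 0)).Local v × (UnitaryGroup.cmDatum L 1 (Matrix.of fun i j : Fin 1 => if i.val + j.val + 1 = 1 then (1 : L) else 0)).Local v) → ℂ} {φ : ((UnitaryGroup.cmDatum L 3 H').Local v) → ℂ} (hφH : IsLocSmooth φH) (hφs : IsLocSmooth φ)
    (hloc : ∀ γH : ((UnitaryGroup.cmDatum L 2 (Matrix.of fun i j : Fin 2 => if i.val + j.val + 1 = 2 then (1 : L) else 0)).Local v × (UnitaryGroup.cmDatum L 1 (Matrix.of fun i j : Fin 1 => if i.val + j.val + 1 = 1 then (1 : L) else 0)).Local v), γH ∈ V → IsLocalGRegular L v γH →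
      stableOrbitalIntegralRel (IsLocalStablyConjH L v) mH φH γH =
        ∑ᶠ c : ConjClasses ((UnitaryGroup.cmDatum L 3 H').Local v), (finExplicitCollection L H' μ hl hr v).Δ γH (Quotient.out c) * classOrbitalIntegral mG φ c)
    (hval : φH z ≠ 0) :
    ∃ (fH : ((UnitaryGroup.cmDatum L 2 (Matrix.of fun i j : Fin 2 => if i.val + j.val + 1 = 2 then (1 : L) else 0)).Local v × (UnitaryGroup.cmDatum L 1 (Matrix.of fun i j : Fin 1 => if i.val + j.val + 1 = 1 then (1 : L) else 0)).Local v) → ℂ) (f : ((UnitaryGroup.cmDatum L 3 H').Local v) → ℂ),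
      IsLocSmooth f ∧ IsLocSmooth fH ∧ IsLocalDeltaTransfer L H' v (finExplicitCollection L H' μ hl hr v) mH mG fH f ∧ fH z ≠ 0 := by
  obtain ⟨w⟩ : Nonempty (UnitaryGroup.PlacesOver L v) := inferInstance
  exact exists_transferPair_apply_ne_zero_of_nhds w (smul_placesOver_eq_of_subsingleton L v (IsCMField.complexConj L) hv w) hex
    (fun a a' b h => finExplicitCollection_Δ_eq_of_isLocalStablyConjH L v H' μ hl hr h b) hV hφH hφs hloc hval

end Patch

end Summit.HodgeConjecture.HodgeConjecture.Cruxes.H413.K2E3GermConstantRegularHRNearCentral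

end
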